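import Literature.NumberTheory.Sieve.PolymathMkEpsScaled
import HarnessLib

/-!
# Polymath 8b §7.2: the functionals `I(F)` and `J_{i,1-ε}(F)` of a cut-off polynomial

Topic `Literature/NumberTheory/Sieve`; third support file of the chain discharging the numerical
leaf `exists_polymathFunctional_fifty_gt`-type statements (Polymath 8b, Theorem 3.13(i),
`M_{50,1/25} > 4`) behind `Literature.NumberTheory.Sieve.frequently_nth_prime_succ_le_add_polymath`.

For the test functions of §7.2, `F = 1_{(1+ε)·R_k} · Q` with `Q` a polynomial, this file reduces
the two functionals of Theorem 3.12 (`PolymathBoundedGaps.lean`) to integrals of polynomials over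
scaled simplices:

* `polymathJ_succ_eq` — Fubini for `J_{m,ρ}` on `Fin (n+1) → ℝ`: splitting off the dummy
  coordinate `t_m ∈ [0,1]` through the volume-preserving `MeasurableEquiv.piFinSuccAbove`
  (as `MaynardTao.maynardJ_succ_eq`), `J_{m,ρ}(F) = ∫_{ρ·R_n} (∫_{u>0} F(insertNth m u s) du)² ds`.
* `polymathJ_indicator_eq` — for `F = 1_{r·R_{n+1}} Q` and `ρ ≤ r`:
  `J_{m,ρ}(F) = ∫_{ρ·R_n} (∫₀^{r − ∑ s} Q(insertNth m u s) du)² ds`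
  (Polymath 8b §7.2: the inner integral runs up to the boundary of the ENLARGED simplex).
* `polymathI_indicator_eq`, `isPolymathTestFunction_indicator` — `I(F) = ∫_{r·R_k} Q²`, and such an
  `F` (with `Q` continuous, `∫ Q² > 0`) is a test function of Theorem 3.12.
* `MkEps.psProd_insertNth'`, `MkEps.intervalIntegral_sub_pow_mul_psProd` — the one-coordinate
  expansion of the power-sum products at an arbitrary place `m` and the inner beta integrals
  `∫₀^L (L−u)^a u^e du = a! e!/(a+e+1)! · L^{a+e+1}` (`MaynardK105.integral_sub_pow_mul_pow`),
  giving `∫₀^L (L−u)^a ∏_p p_{v_p}^{c_p}(insertNth m u s) du` as a polynomial of the same shape in `s`.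
* `MkEps.psProd_add` — `∏ p^{c} · ∏ p^{c'} = ∏ p^{c+c'}` (products of basis elements are basis
  elements: the reason power-sum products are used instead of monomial symmetric functions).

## References
* [Polymath8b2014] D. H. J. Polymath, *Variants of the Selberg sieve, and bounded intervals
  containing many primes*, Res. Math. Sci. 1 (2014), Art. 12 = arXiv:1407.4897, Theorem 3.12 and §7.2.
* [MaynardAnnals2015] J. Maynard, *Small gaps between primes*, Ann. of Math. 181 (2015), §7.
-/

open MeasureTheory Set Filter Finset intervalIntegral
open scoped BigOperators

noncomputable section

namespace Literature.NumberTheory.Sieve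

/-! ### Slicing `J_{m,ρ}` along the dummy coordinate -/

/-- Membership of `Fin.insertNth m u s` in `r • R_{n+1}`. [folklore] -/
theorem insertNth_mem_scaledSimplex_iff {n : ℕ} (m : Fin (n + 1)) (r u : ℝ) (s : Fin n → ℝ) :
    (Fin.insertNth m u s : Fin (n + 1) → ℝ) ∈ scaledSimplex (n + 1) r ↔
      (∀ i, 0 ≤ s i) ∧ 0 ≤ u ∧ u + ∑ i, s i ≤ r := by
  simp only [scaledSimplex, Set.mem_setOf_eq]
  rw [Fin.forall_iff_succAbove m, Fin.sum_univ_succAbove _ m]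
  simp only [Fin.insertNth_apply_same, Fin.insertNth_apply_succAbove]
  tauto

/-- `∑_{j ≠ m} (insertNth m u s)_j = ∑_i s_i`. [folklore] -/
theorem sum_erase_self_insertNth {n : ℕ} (m : Fin (n + 1)) (u : ℝ) (s : Fin n → ℝ) :
    ∑ j ∈ univ.erase m, (Fin.insertNth m u s : Fin (n + 1) → ℝ) j = ∑ i, s i := by
  have h := Finset.sum_erase_add (f := (Fin.insertNth m u s : Fin (n + 1) → ℝ)) univ (Finset.mem_univ m)
  rw [Fin.sum_insertNth m u s, Fin.insertNth_apply_same] at h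
  linarith

/-- `r • R_k` is compact. [folklore] -/
theorem isCompact_scaledSimplex (k : ℕ) (r : ℝ) : IsCompact (scaledSimplex k r) := by
  refine (isCompact_univ_pi fun _ : Fin k => (isCompact_Icc : IsCompact (Set.Icc (0:ℝ) r))).of_isClosed_subset
    (isClosed_scaledSimplex k r) fun t ht => ?_
  simp only [Set.mem_pi, Set.mem_univ, true_implies, Set.mem_Icc]
  intro i
  refine ⟨ht.1 i, le_trans ?_ ht.2⟩
  exact Finset.single_le_sum (fun j _ => ht.1 j) (Finset.mem_univ i)

/-- Every coordinate of a point of `r • R_k` lies in `[0, r]`. [folklore] -/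
theorem apply_mem_Icc_of_mem_scaledSimplex {k : ℕ} {r : ℝ} {t : Fin k → ℝ}
    (ht : t ∈ scaledSimplex k r) (i : Fin k) : t i ∈ Icc 0 r :=
  ⟨ht.1 i, le_trans (Finset.single_le_sum (fun j _ => ht.1 j) (Finset.mem_univ i)) ht.2⟩

/-- `r • R_k` lies in the box `[0, r]^k`. [folklore] -/
theorem scaledSimplex_subset_Icc (k : ℕ) (r : ℝ) :
    scaledSimplex k r ⊆ Icc (0 : Fin k → ℝ) (fun _ => r) := fun _ ht =>
  ⟨fun i => (apply_mem_Icc_of_mem_scaledSimplex ht i).1,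
    fun i => (apply_mem_Icc_of_mem_scaledSimplex ht i).2⟩

/-- `r • R_k` has finite Lebesgue measure (it is compact). [folklore] -/
theorem volume_scaledSimplex_lt_top (k : ℕ) (r : ℝ) : volume (scaledSimplex k r) < ⊤ :=
  (isCompact_scaledSimplex k r).measure_lt_top

/-- **Fubini for `J_{m,ρ}`**: splitting off the dummy coordinate `t_m` (`e.symm (x, s) = insertNth m x s`
for `e = MeasurableEquiv.piFinSuccAbove _ m`), the integrand of `polymathJ` does not depend on `t_m`,
whose fibre `[0, 1]` has length `1`:
`J_{m,ρ}(F) = ∫_{ρ·R_n} (∫_{u > 0} F(insertNth m u s) du)² ds`. [cite: Polymath8b2014, Theorem 3.12, definition of J_{i,1-ε}] -/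
theorem polymathJ_succ_eq {n : ℕ} (ρ : ℝ) (m : Fin (n + 1)) (F : (Fin (n + 1) → ℝ) → ℝ) :
    polymathJ (n + 1) ρ m F =
      ∫ s in scaledSimplex n ρ, (∫ u in Set.Ioi (0:ℝ), F (Fin.insertNth m u s)) ^ 2 := by
  set e := MeasurableEquiv.piFinSuccAbove (fun _ : Fin (n + 1) => ℝ) m with he_def
  have he : MeasurePreserving e.symm (volume.prod volume) volume := by
    have := (volume_preserving_piFinSuccAbove (fun _ : Fin (n + 1) => ℝ) m).symm
    rwa [Measure.volume_eq_prod] at this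
  have he_apply : ∀ p : ℝ × (Fin n → ℝ), e.symm p = Fin.insertNth m p.1 p.2 := fun p => by
    rw [he_def, MeasurableEquiv.piFinSuccAbove_symm_apply]; rfl
  have hpre : e.symm ⁻¹' polymathJRegion (n + 1) ρ m = Icc (0:ℝ) 1 ×ˢ scaledSimplex n ρ := by
    ext ⟨x, s⟩
    simp only [polymathJRegion, scaledSimplex, Set.mem_preimage, he_apply, Set.mem_setOf_eq, Set.mem_prod,
      Set.mem_Icc]
    rw [Fin.forall_iff_succAbove m, sum_erase_self_insertNth]
    simp only [Fin.insertNth_apply_same, Fin.insertNth_apply_succAbove]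
    tauto
  rw [polymathJ, ← he.setIntegral_preimage_emb e.symm.measurableEmbedding, hpre]
  simp_rw [he_apply, Fin.update_insertNth]
  have := setIntegral_prod_mul (μ := (volume : Measure ℝ)) (ν := (volume : Measure (Fin n → ℝ)))
    (fun _ : ℝ => (1:ℝ))
    (fun s : Fin n → ℝ => (∫ u in Set.Ioi (0:ℝ), F (Fin.insertNth m u s)) ^ 2) (Icc 0 1)
    (scaledSimplex n ρ)
  simp only [one_mul] at this
  rw [this]
  simp

/-- **`J_{m,ρ}` of a cut-off function** (Polymath 8b §7.2; cf. `MaynardTao.maynardJ_indicator_eq`):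
for `F = 1_{r·R_{n+1}} · Q` and `ρ ≤ r`,
`J_{m,ρ}(F) = ∫_{ρ·R_n} (∫₀^{r − ∑ sᵢ} Q(insertNth m u s) du)² ds` — the inner integration runs to
the boundary of the enlarged simplex. [cite: Polymath8b2014, §7.2] -/
theorem polymathJ_indicator_eq {n : ℕ} {ρ r : ℝ} (hρr : ρ ≤ r) (m : Fin (n + 1))
    (Q : (Fin (n + 1) → ℝ) → ℝ) :
    polymathJ (n + 1) ρ m ((scaledSimplex (n + 1) r).indicator Q) =
      ∫ s in scaledSimplex n ρ, (∫ u in (0:ℝ)..(r - ∑ i, s i), Q (Fin.insertNth m u s)) ^ 2 := by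
  rw [polymathJ_succ_eq]
  refine setIntegral_congr_fun (measurableSet_scaledSimplex n ρ) fun s hs => ?_
  have hs0 : ∀ i, 0 ≤ s i := hs.1
  have hL : 0 ≤ r - ∑ i, s i := by linarith [hs.2]
  congr 1
  have hind : ∀ u, (scaledSimplex (n + 1) r).indicator Q (Fin.insertNth m u s) =
      (Icc 0 (r - ∑ i, s i)).indicator (fun u => Q (Fin.insertNth m u s)) u := by
    intro u
    by_cases hu : u ∈ Icc 0 (r - ∑ i, s i)
    · rw [Set.indicator_of_mem hu, Set.indicator_of_mem]
      exact (insertNth_mem_scaledSimplex_iff m r u s).2 ⟨hs0, hu.1, by linarith [hu.2]⟩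
    · rw [Set.indicator_of_notMem hu, Set.indicator_of_notMem]
      intro h
      obtain ⟨-, h0, h1⟩ := (insertNth_mem_scaledSimplex_iff m r u s).1 h
      exact hu ⟨h0, by linarith⟩
  simp_rw [hind]
  rw [setIntegral_indicator measurableSet_Icc, intervalIntegral.integral_of_le hL]
  have hset : Set.Ioi (0:ℝ) ∩ Icc 0 (r - ∑ i, s i) = Set.Ioc 0 (r - ∑ i, s i) := by
    ext u
    simp only [Set.mem_inter_iff, Set.mem_Ioi, Set.mem_Icc, Set.mem_Ioc]
    constructor
    · rintro ⟨h1, -, h3⟩; exact ⟨h1, h3⟩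
    · rintro ⟨h1, h2⟩; exact ⟨h1, h1.le, h2⟩
  rw [hset]

/-- `I(1_{r·R_k} · Q) = ∫_{r·R_k} Q²`. [cite: Polymath8b2014, §7.2] -/
theorem polymathI_indicator_eq (k : ℕ) (r : ℝ) (Q : (Fin k → ℝ) → ℝ) :
    polymathI k ((scaledSimplex k r).indicator Q) = ∫ t in scaledSimplex k r, Q t ^ 2 := by
  rw [polymathI_eq_setIntegral_of_support_subset (r := r) Set.support_indicator_subset]
  refine setIntegral_congr_fun (measurableSet_scaledSimplex k r) fun t ht => ?_
  simp only [Set.indicator_of_mem ht]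

/-- A cut-off continuous function `F = 1_{(1+ε)·R_k} · Q` with `∫_{(1+ε)·R_k} Q² > 0` is a test
function of Theorem 3.12 (Polymath 8b §7.2: the class used for the lower bounds on `M_{k,ε}`).
[cite: Polymath8b2014, §7.2] -/
theorem isPolymathTestFunction_indicator {k : ℕ} {ε : ℝ} {Q : (Fin k → ℝ) → ℝ} (hQ : Continuous Q)
    (hpos : 0 < ∫ t in scaledSimplex k (1 + ε), Q t ^ 2) :
    IsPolymathTestFunction k ε ((scaledSimplex k (1 + ε)).indicator Q) where
  measurable := hQ.measurable.indicator (measurableSet_scaledSimplex k _)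
  support_subset := Set.support_indicator_subset
  integrableOn_sq := by
    have h : IntegrableOn (fun t => Q t ^ 2) (scaledSimplex k (1 + ε)) :=
      (hQ.pow 2).continuousOn.integrableOn_compact (isCompact_scaledSimplex k _)
    refine (integrableOn_congr_fun (fun t ht => ?_) (measurableSet_scaledSimplex k _)).2 h
    simp only [Set.indicator_of_mem ht]
  polymathI_pos := by rwa [polymathI_indicator_eq]

namespace MkEps

variable {P : ℕ}

/-! ### One-coordinate expansions at an arbitrary place `m` -/

/-- `∑_i (insertNth m u s)_i^w = u^w + ∑_j s_j^w` for every place `m`. [folklore] -/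
theorem sum_pow_insertNth_eq' {n : ℕ} (m : Fin (n + 1)) (u : ℝ) (s : Fin n → ℝ) (w : ℕ) :
    ∑ i, (Fin.insertNth m u s : Fin (n + 1) → ℝ) i ^ w = u ^ w + ∑ j, s j ^ w := by
  simp only [Fin.sum_univ_succAbove _ m, Fin.insertNth_apply_same, Fin.insertNth_apply_succAbove]

/-- The power-sum products do not see the place of insertion. [folklore] -/
theorem psProd_insertNth_eq_zero_place {n : ℕ} (v : Fin P → ℕ) (c : Fin P → ℕ) (m : Fin (n + 1))
    (u : ℝ) (s : Fin n → ℝ) :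
    psProd v c (Fin.insertNth m u s) = psProd v c (Fin.insertNth 0 u s) := by
  unfold psProd
  simp_rw [sum_pow_insertNth_eq']

/-- **The one-coordinate expansion at place `m`**:
`psProd v c (insertNth m u s) = ∑_{j ≤ c} (∏_p C(c_p,j_p)) u^{∑ v_p j_p} psProd v (c - j) s`. [folklore] -/
theorem psProd_insertNth' {n : ℕ} (v : Fin P → ℕ) (c : Fin P → ℕ) (m : Fin (n + 1)) (u : ℝ)
    (s : Fin n → ℝ) :
    psProd v c (Fin.insertNth m u s) =
      ∑ j ∈ Fintype.piFinset (fun p => Finset.range (c p + 1)),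
        ((∏ p, ((c p).choose (j p) : ℝ)) * u ^ (∑ p, v p * j p)) * psProd v (c - j) s := by
  rw [psProd_insertNth_eq_zero_place, psProd_insertNth]

/-- Products of power-sum products: `∏ p^{c} · ∏ p^{c'} = ∏ p^{c + c'}`. [folklore] -/
theorem psProd_add {k : ℕ} (v : Fin P → ℕ) (c c' : Fin P → ℕ) (t : Fin k → ℝ) :
    psProd v c t * psProd v c' t = psProd v (c + c') t := by
  unfold psProd
  rw [← Finset.prod_mul_distrib]
  refine Finset.prod_congr rfl fun p _ => ?_
  rw [Pi.add_apply, pow_add]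

/-- `deg (c + c') = deg c + deg c'`. [folklore] -/
theorem psDeg_add (v : Fin P → ℕ) (c c' : Fin P → ℕ) : psDeg v (c + c') = psDeg v c + psDeg v c' := by
  unfold psDeg
  rw [← Finset.sum_add_distrib]
  refine Finset.sum_congr rfl fun p _ => ?_
  rw [Pi.add_apply, Nat.mul_add]

/-- `r − P₁(insertNth m u s) = (r − ∑ s) − u`. [folklore] -/
theorem sub_sum_insertNth {n : ℕ} (m : Fin (n + 1)) (r u : ℝ) (s : Fin n → ℝ) :
    r - ∑ i, (Fin.insertNth m u s : Fin (n + 1) → ℝ) i = (r - ∑ j, s j) - u := by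
  rw [Fin.sum_insertNth]; ring

/-- **The inner beta integrals of `J`** (Polymath 8b §7.2 with Maynard's Lemma 7.1 computation):
`∫₀^L (L − u)^a ∏_p p_{v_p}^{c_p}(insertNth m u s) du
  = ∑_{j ≤ c} (∏_p C(c_p,j_p)) · a! e_j!/(a + e_j + 1)! · L^{a+e_j+1} · ∏_p p_{v_p}^{c_p − j_p}(s)`,
`e_j = ∑_p v_p j_p`. [cite: Polymath8b2014, §7.2] -/
theorem intervalIntegral_sub_pow_mul_psProd {n : ℕ} (v : Fin P → ℕ) (c : Fin P → ℕ) (m : Fin (n + 1))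
    (a : ℕ) (L : ℝ) (s : Fin n → ℝ) :
    ∫ u in (0:ℝ)..L, (L - u) ^ a * psProd v c (Fin.insertNth m u s) =
      ∑ j ∈ Fintype.piFinset (fun p => Finset.range (c p + 1)),
        (∏ p, ((c p).choose (j p) : ℝ)) *
          (L ^ (a + (∑ p, v p * j p) + 1) *
            (((a.factorial * (∑ p, v p * j p).factorial : ℕ) : ℝ) / (a + (∑ p, v p * j p) + 1).factorial)) *
          psProd v (c - j) s := by
  simp_rw [psProd_insertNth' v c m]
  simp_rw [Finset.mul_sum]
  rw [intervalIntegral.integral_finsetSum fun j _ => ?_]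
  · refine Finset.sum_congr rfl fun j _ => ?_
    have h : ∀ u : ℝ, (L - u) ^ a * ((∏ p, ((c p).choose (j p) : ℝ)) * u ^ (∑ p, v p * j p) * psProd v (c - j) s) =
        ((∏ p, ((c p).choose (j p) : ℝ)) * psProd v (c - j) s) * ((L - u) ^ a * u ^ (∑ p, v p * j p)) := by
      intro u; ring
    simp_rw [h]
    rw [intervalIntegral.integral_const_mul, MaynardK105.integral_sub_pow_mul_pow]
    ring
  · exact (Continuous.intervalIntegrable (by fun_prop) _ _)

end MkEps

end Literature.NumberTheory.Sieve
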